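import Literature.Analysis.Complex.LengthAreaDiameter
import Literature.Analysis.Complex.KoebeDistortion
import Literature.Analysis.Complex.KoebeQuarterProofs
import Mathlib.Analysis.SpecialFunctions.Complex.LogDeriv
import Mathlib.Analysis.SpecialFunctions.Complex.Arg
import Mathlib.Analysis.SpecialFunctions.Trigonometric.Bounds
import Mathlib.Analysis.Complex.AbsMax
import Mathlib.MeasureTheory.Measure.Haar.Unique
import Mathlib.Analysis.Real.Pi.Bounds
import HarnessLib

/-!
# Far boundary features have small conformal images (length–area)

Topic `Literature/Analysis/Complex` (conformal maps; companion of `LengthAreaDiameter.lean`).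
Let `g : U → 𝔻` be a conformal bijection of an open set `U ⊆ ℂ` onto the unit disc with
(holomorphic) inverse `f`, normalised at the interior point `z₀ = f 0`. We prove:

> **`norm_sub_le_of_far`.** If `Q ⊆ U ∩ B(p, d)` is preconnected, `0 < d < 1`, some point
> `b ∉ U` has `‖b - p‖ ≤ 1`, and `‖z₀ - p‖ ≥ 2`, then for all `z₁, z₂ ∈ Q`,
> `‖g z₁ - g z₂‖ ≤ 1400 / √(log (1/d))`.

In words: a connected piece of `U` of size `d` next to the boundary, seen from a base point at
distance `≥ 2`, has conformal image of diameter `O(1/√(log(1/d)))`; by scaling, a boundary feature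
of bounded size at distance `R` from the base point has image of diameter `O(1/√(log R))`
(`norm_sub_le_of_far_scaled`); and, combining with Schwarz–Pick for deep sets
(`norm_sub_le_of_deep`), **`norm_sub_le_of_inradius`**: if the inner radius at the base point is
`ρ ≥ 8` then EVERY preconnected `Q ⊆ U` of diameter `< 1` (inside a unit disc) has image of
diameter `≤ 1500/√(log(ρ/3))` — lattice steps are uniformly small in conformal coordinates. This
is the purely function-theoretic substitute, sufficient for
qualitative purposes, for the Beurling estimate "the harmonic measure from `z₀` of a set of
diameter `1` at distance `R` is `O(R^{-1/2})`", in the form in which G. F. Lawler, O. Schramm,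
W. Werner, *Conformal invariance of planar loop-erased random walks and uniform spanning trees*,
Ann. Probab. 32 (2004), use it in §3.3 and §4.2 (arXiv version, p. 22: "there clearly is such
`Q₀` when `r₀` is large, because the harmonic measure from `0` of any square of the dual grid
adjacent to the boundary of `D` is small"; the one-lattice-step increments of the driving
function and of the capacity are small when the inner radius is large; the arcs `A'_j` near the
boundary "correspond" to arcs of `∂𝕌` under `ψ_D`, Prop. 4.1).

## Proof (Wolff's length–area argument about the centre `p`, and two crossing tricks)

1. Length–area (`LengthAreaDiameter.lean`, Pommerenke (1992), Prop. 2.2): since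
   `area g(U ∩ B(p,1)) ≤ π`, some circle `{|z - p| = ρ}`, `d < ρ < √d`, has
   `Γ_ρ := g(U ∩ {|z - p| = ρ})` of total length `ℓ ≤ c₀ = √(4(2π²+1)/log(1/d))`.
2. `Γ_ρ` stays away from the centre: `|w| ≥ 1/48` on `Γ_ρ` (growth theorem
   `norm_sub_le_growth` and Koebe's one-quarter theorem `koebeQuarter_holds`, using `b`).
3. *Circle trick* (`exists_mem_sphere_norm_eq`): for `q ∈ Q` the circle `{|w| = |g q|}` is
   mapped by `f` onto a closed curve through `q` which, by the **maximum principle** for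
   `f - p` on `{|w| ≤ |g q|}`, reaches distance `≥ ‖z₀ - p‖ > ρ` from `p`; by continuity it
   meets `{|z - p| = ρ}` inside `U`, so `|g q| ∈ {|w| : w ∈ Γ_ρ}`.
4. *Radial trick* (`exists_mem_sphere_eq_mul`): the radius `[0, g q]` is mapped by `f` onto a
   path from `z₀` to `q`, which crosses the circle, so `arg (g q) ∈ arg(Γ_ρ)` (and the same for
   `arg (-g q)`).
5. The sets `{log |w|}`, `{arg w}`, `{arg (-w)}` over `w ∈ Γ_ρ` have Lebesgue measure `≤ 96 c₀`,
   `48 c₀`, `48 c₀`: they are projections `re`, `im` of the images of the circle pieces under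
   the holomorphic maps `log ∘ g`, `log ∘ (-g)` (on the open sets where `±g ∈ slitPlane`), whose
   derivatives are `≤ 48 |g'|` by step 2 (`volume_image_image_le`).
6. Over `q ∈ Q` the values `log |g q|` form an interval (connectedness) inside a set of measure
   `≤ 96 c₀`, so the moduli `|g q|` vary by `≤ 96 c₀`; if `g(Q)` misses the negative (or the
   positive) real axis the arguments `arg (±g q)` form an interval of length `≤ 48 c₀` and the
   chord bound gives `‖g z₁ - g z₂‖ ≤ 144 c₀`; if `g(Q)` meets both half-axes then
   `|arg ∘ g| = arccos(re/|·|)` takes all values of `[0, π]` on `Q`, forcing `π ≤ 96 c₀`, and the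
   bound holds trivially. Finally `144 c₀ ≤ 1400/√(log(1/d))`.

No Brownian motion, harmonic measure or extremal length is used; everything is proved.

## References

* Ch. Pommerenke, *Boundary Behaviour of Conformal Maps*, Springer (1992), Prop. 2.2 and
  Cor. 2.3 (Wolff's lemma). [PommerenkeBBCM1992]
* G. F. Lawler, O. Schramm, W. Werner, Ann. Probab. 32 (2004) 939–995, §4.2 (arXiv
  math/0112234, p. 22). [LawlerSchrammWerner2004]
-/

noncomputable section

open Set Filter Metric MeasureTheory Real
open _root_.Complex _root_.Topology
open scoped ENNReal NNReal

namespace Literature.Analysis.Complex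

namespace FarSet

open LengthArea

/-! ### Elementary inequalities -/

/-- On `(0, 1]` the logarithm expands distances: `|s₁ - s₂| ≤ |log s₁ - log s₂|`. [folklore] -/
theorem abs_sub_le_abs_log_sub_log {s₁ s₂ : ℝ} (h₁ : 0 < s₁) (h₁' : s₁ ≤ 1) (h₂ : 0 < s₂)
    (h₂' : s₂ ≤ 1) : |s₁ - s₂| ≤ |Real.log s₁ - Real.log s₂| := by
  wlog hle : s₁ ≤ s₂ generalizing s₁ s₂
  · rw [abs_sub_comm, abs_sub_comm (Real.log s₁)]
    exact this h₂ h₂' h₁ h₁' (le_of_not_ge hle)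
  have hlog : Real.log s₁ ≤ Real.log s₂ := Real.log_le_log h₁ hle
  rw [abs_of_nonpos (by linarith), abs_of_nonpos (by linarith)]
  -- `log s₂ - log s₁ = log (s₂/s₁) ≥ 1 - s₁/s₂ = (s₂ - s₁)/s₂ ≥ s₂ - s₁`
  have h := Real.one_sub_inv_le_log_of_pos (div_pos h₂ h₁)
  rw [Real.log_div h₂.ne' h₁.ne', inv_div] at h
  have h3 : s₂ - s₁ ≤ 1 - s₁ / s₂ := by
    have h4 : s₂ - s₁ ≤ (s₂ - s₁) / s₂ := le_div_self (sub_nonneg.2 hle) h₂ h₂'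
    rwa [sub_div, div_self h₂.ne'] at h4
  linarith

/-- The chord is at most the arc: `‖e^{ia} - e^{ib}‖ ≤ |a - b|`. [folklore] -/
theorem norm_exp_mul_I_sub_le (a b : ℝ) :
    ‖Complex.exp (a * I) - Complex.exp (b * I)‖ ≤ |a - b| := by
  have h : Complex.exp (a * I) - Complex.exp (b * I) =
      Complex.exp (b * I) * (Complex.exp (I * (a - b : ℝ)) - 1) := by
    rw [mul_sub, mul_one, ← Complex.exp_add]
    congr 1
    push_cast
    ring_nf
  rw [h, norm_mul, Complex.norm_exp_ofReal_mul_I, one_mul]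
  have := Real.norm_exp_I_mul_ofReal_sub_one_le (x := a - b)
  rwa [Real.norm_eq_abs] at this

/-- Polar chord bound: for `y` in the closed unit disc,
`‖x - y‖ ≤ |‖x‖ - ‖y‖| + |arg x - arg y|`. [folklore] -/
theorem norm_sub_le_abs_norm_sub_add_abs_arg_sub (x : ℂ) {y : ℂ} (hy : ‖y‖ ≤ 1) :
    ‖x - y‖ ≤ |‖x‖ - ‖y‖| + |arg x - arg y| := by
  set u : ℂ := Complex.exp (arg x * I) with hu
  set v : ℂ := Complex.exp (arg y * I) with hv
  have hxu : x = ‖x‖ * u := (norm_mul_exp_arg_mul_I x).symm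
  have hyv : y = ‖y‖ * v := (norm_mul_exp_arg_mul_I y).symm
  have hun : ‖u‖ = 1 := Complex.norm_exp_ofReal_mul_I _
  have key : x - y = (‖x‖ - ‖y‖ : ℝ) * u + (‖y‖ : ℂ) * (u - v) := by
    conv_lhs => rw [hxu, hyv]
    push_cast; ring
  calc ‖x - y‖ = ‖(‖x‖ - ‖y‖ : ℝ) * u + (‖y‖ : ℂ) * (u - v)‖ := by rw [← key]
    _ ≤ ‖(‖x‖ - ‖y‖ : ℝ) * u‖ + ‖(‖y‖ : ℂ) * (u - v)‖ := norm_add_le _ _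
    _ = |‖x‖ - ‖y‖| + ‖y‖ * ‖u - v‖ := by
        rw [norm_mul, norm_mul, Complex.norm_real, Real.norm_eq_abs, hun, mul_one,
          Complex.norm_real, Real.norm_eq_abs, abs_of_nonneg (norm_nonneg y)]
    _ ≤ |‖x‖ - ‖y‖| + 1 * |arg x - arg y| := by
        gcongr
        exact norm_exp_mul_I_sub_le _ _
    _ = |‖x‖ - ‖y‖| + |arg x - arg y| := by rw [one_mul]

/-- `|arg x| = arccos (re x / |x|)` for `x ≠ 0`; in particular `|arg|` is continuous off `0`.
[folklore] -/
theorem abs_arg_eq_arccos {x : ℂ} (hx : x ≠ 0) : |arg x| = Real.arccos (x.re / ‖x‖) := by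
  rw [← Complex.cos_arg hx, ← Real.cos_abs, Real.arccos_cos (abs_nonneg _) (abs_arg_le_pi x)]

/-- Outside the slit plane a nonzero complex number has argument `π`. [folklore] -/
theorem arg_eq_pi_of_not_mem_slitPlane {x : ℂ} (hx : x ∉ slitPlane) (hx0 : x ≠ 0) : arg x = π := by
  by_contra h
  exact hx (mem_slitPlane_iff_arg.2 ⟨h, hx0⟩)

/-! ### The conformal disc map: distance from the centre -/

/-- **Points far from the base point are not mapped near the centre.** Let `f` be holomorphic
and injective on `𝔻` with values in `U`, let `b ∉ U` with `‖b - p‖ ≤ 1` and `‖f 0 - p‖ ≥ 2`.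
If `‖w‖ < 1` and `‖f w - p‖ ≤ 1` then `‖w‖ ≥ 1/48`. (Koebe's one-quarter theorem gives
`|f'(0)| ≤ 4 |b - f(0)| ≤ 4 (1 + |f(0) - p|)`, and the growth theorem
`|f(w) - f(0)| ≤ |f'(0)| |w|/(1 - |w|)²`.) [cite: PommerenkeBBCM1992, Thm. 1.3] -/
theorem one_div_le_norm_of_far {f : ℂ → ℂ} (hf : DifferentiableOn ℂ f (ball 0 1))
    (hinj : InjOn f (ball 0 1)) {U : Set ℂ} (hfU : MapsTo f (ball 0 1) U) {p b : ℂ}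
    (hb : b ∉ U) (hbp : ‖b - p‖ ≤ 1) (hA : 2 ≤ ‖f 0 - p‖) {w : ℂ} (hw : ‖w‖ < 1)
    (hz : ‖f w - p‖ ≤ 1) : (1 / 48 : ℝ) ≤ ‖w‖ := by
  -- Koebe 1/4
  have hK : ‖deriv f 0‖ ≤ 4 * (1 + ‖f 0 - p‖) := by
    by_contra hlt
    push Not at hlt
    have hmem : b ∈ ball (f 0) (‖deriv f 0‖ / 4) := by
      rw [mem_ball, dist_eq_norm]
      calc ‖b - f 0‖ = ‖(b - p) - (f 0 - p)‖ := by ring_nf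
        _ ≤ ‖b - p‖ + ‖f 0 - p‖ := norm_sub_le _ _
        _ ≤ 1 + ‖f 0 - p‖ := by linarith
        _ < ‖deriv f 0‖ / 4 := by linarith
    obtain ⟨w', hw', hfw'⟩ := koebeQuarter_holds f hf hinj hmem
    exact hb (hfw' ▸ hfU hw')
  by_contra hlt
  push Not at hlt
  have hgrowth := AreaThm.norm_sub_le_growth hf hinj (mem_ball_zero_iff.1 (mem_ball_zero_iff.2 hw))
  have h1 : ‖f 0 - p‖ - 1 ≤ ‖f w - f 0‖ := by
    have : ‖f 0 - p‖ ≤ ‖f w - p‖ + ‖f w - f 0‖ := by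
      calc ‖f 0 - p‖ = ‖(f w - p) - (f w - f 0)‖ := by ring_nf
        _ ≤ ‖f w - p‖ + ‖f w - f 0‖ := norm_sub_le _ _
    linarith
  have hw0 : 0 ≤ ‖w‖ := norm_nonneg w
  have hden : (1 : ℝ) / 4 ≤ (1 - ‖w‖) ^ 2 := by nlinarith
  have h2 : ‖w‖ / (1 - ‖w‖) ^ 2 ≤ 4 * ‖w‖ := by
    rw [div_le_iff₀ (by positivity)]
    nlinarith
  have h3 : ‖f w - f 0‖ ≤ 4 * (1 + ‖f 0 - p‖) * (4 * ‖w‖) :=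
    hgrowth.trans (mul_le_mul hK h2 (by positivity) (by positivity))
  nlinarith

/-! ### The two crossing tricks -/

section Tricks

variable {U : Set ℂ} {g f : ℂ → ℂ}
  (hf : DifferentiableOn ℂ f (ball 0 1)) (hfU : MapsTo f (ball 0 1) U)
  (hgU : MapsTo g U (ball 0 1)) (hfg : ∀ z ∈ U, f (g z) = z)
  (hgf : ∀ w ∈ ball (0 : ℂ) 1, g (f w) = w)
include hf hfU hgU hfg hgf

/-- **Circle trick.** For `q ∈ U` with `‖q - p‖ < ρ < ‖f 0 - p‖` there is a point `z ∈ U` on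
the circle `{|z - p| = ρ}` with `|g z| = |g q|`: by the maximum principle `f - p` attains on
the circle `{|w| = |g q|}` a modulus `≥ ‖f 0 - p‖ > ρ`, while at `w = g q` its modulus is `< ρ`;
apply the intermediate value theorem along the circle. [folklore] -/
theorem exists_mem_sphere_norm_eq {p : ℂ} {ρ : ℝ} (hρ : ρ < ‖f 0 - p‖) {q : ℂ} (hqU : q ∈ U)
    (hq : ‖q - p‖ < ρ) : ∃ z ∈ U ∩ sphere p ρ, ‖g z‖ = ‖g q‖ := by
  set w₀ : ℂ := g q with hw₀
  set s : ℝ := ‖w₀‖ with hs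
  have hs1 : s < 1 := mem_ball_zero_iff.1 (hgU hqU)
  have hs0 : 0 < s := by
    rw [hs, norm_pos_iff]
    intro h0
    have : q = f 0 := by rw [← hfg q hqU, ← hw₀, h0]
    rw [this] at hq
    linarith
  have hsub : closedBall (0 : ℂ) s ⊆ ball 0 1 := closedBall_subset_ball hs1
  -- maximum principle on the closed disc of radius `s`
  have hdc : DiffContOnCl ℂ (fun w ↦ f w - p) (ball 0 s) := by
    refine DifferentiableOn.diffContOnCl ?_
    rw [closure_ball (0 : ℂ) hs0.ne']
    exact (hf.sub_const p).mono hsub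
  obtain ⟨w₁, hw₁, hmax⟩ := Complex.exists_mem_frontier_isMaxOn_norm isBounded_ball
    (nonempty_ball.2 hs0) hdc
  rw [frontier_ball (0 : ℂ) hs0.ne'] at hw₁
  have h0 : ‖f 0 - p‖ ≤ ‖f w₁ - p‖ := by
    have := hmax (subset_closure (mem_ball_self hs0))
    simpa using this
  -- parametrise the circle
  obtain ⟨θ₀, -, hθ₀⟩ := exists_eq_circleMap_of_norm_sub 0 (z := w₀) (r := s) (by simp [hs])
  obtain ⟨θ₁, -, hθ₁⟩ := exists_eq_circleMap_of_norm_sub 0 (z := w₁) (r := s)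
    (by simpa using hw₁)
  set φ : ℝ → ℝ := fun t ↦ ‖f (circleMap 0 s t) - p‖ with hφ
  have hmem : ∀ t, circleMap 0 s t ∈ ball (0 : ℂ) 1 := fun t ↦ by
    rw [mem_ball_zero_iff, norm_circleMap_zero, abs_of_pos hs0]; exact hs1
  have hcont : Continuous φ := by
    have h1 : Continuous fun t ↦ f (circleMap 0 s t) :=
      hf.continuousOn.comp_continuous (continuous_circleMap 0 s) hmem
    exact (h1.sub continuous_const).norm
  have hφ₀ : φ θ₀ < ρ := by
    simp only [hφ, ← hθ₀, hw₀, hfg q hqU]; exact hq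
  have hφ₁ : ρ < φ θ₁ := by
    simp only [hφ, ← hθ₁]; exact hρ.trans_le h0
  obtain ⟨t, -, ht⟩ := intermediate_value_uIcc hcont.continuousOn
    (show ρ ∈ uIcc (φ θ₀) (φ θ₁) from mem_uIcc.2 (Or.inl ⟨hφ₀.le, hφ₁.le⟩))
  refine ⟨f (circleMap 0 s t), ⟨hfU (hmem t), mem_sphere_iff_norm.2 ht⟩, ?_⟩
  rw [hgf _ (hmem t), norm_circleMap_zero, abs_of_pos hs0]

/-- **Radial trick.** For `q ∈ U` with `‖q - p‖ < ρ < ‖f 0 - p‖` there is a point `z ∈ U` on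
the circle `{|z - p| = ρ}` whose image `g z` is a positive multiple of `g q`: the radius
`[0, g q]` is mapped by `f` onto a path from `f 0` to `q`, which crosses the circle. [folklore] -/
theorem exists_mem_sphere_eq_mul {p : ℂ} {ρ : ℝ} (hρ : ρ < ‖f 0 - p‖) {q : ℂ} (hqU : q ∈ U)
    (hq : ‖q - p‖ < ρ) : ∃ z ∈ U ∩ sphere p ρ, ∃ t : ℝ, 0 < t ∧ g z = t * g q := by
  set w₀ : ℂ := g q with hw₀
  have hw1 : ‖w₀‖ < 1 := mem_ball_zero_iff.1 (hgU hqU)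
  have hmem : ∀ t ∈ Icc (0 : ℝ) 1, (t : ℂ) * w₀ ∈ ball (0 : ℂ) 1 := fun t ht ↦ by
    rw [mem_ball_zero_iff, norm_mul, Complex.norm_real, Real.norm_eq_abs, abs_of_nonneg ht.1]
    calc t * ‖w₀‖ ≤ 1 * ‖w₀‖ := by gcongr; exact ht.2
      _ < 1 := by rw [one_mul]; exact hw1
  set ψ : ℝ → ℝ := fun t ↦ ‖f (t * w₀) - p‖ with hψ
  have hcont : ContinuousOn ψ (Icc 0 1) := by
    have h1 : ContinuousOn (fun t : ℝ ↦ f (t * w₀)) (Icc 0 1) :=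
      hf.continuousOn.comp (by fun_prop) hmem
    exact (h1.sub continuousOn_const).norm
  have hψ0 : ρ < ψ 0 := by simp only [hψ, ofReal_zero, zero_mul]; exact hρ
  have hψ1 : ψ 1 < ρ := by
    simp only [hψ, ofReal_one, one_mul, hw₀, hfg q hqU]; exact hq
  obtain ⟨t, ht, htρ⟩ := intermediate_value_Icc' zero_le_one hcont ⟨hψ1.le, hψ0.le⟩
  have ht0 : t ≠ 0 := by
    rintro rfl
    exact (lt_irrefl ρ) (htρ ▸ hψ0)
  refine ⟨f (t * w₀), ⟨hfU (hmem t ht), mem_sphere_iff_norm.2 htρ⟩, t,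
    lt_of_le_of_ne ht.1 (Ne.symm ht0), ?_⟩
  rw [hgf _ (hmem t ht)]

end Tricks

/-! ### Comparison of angular lengths -/

/-- Comparison of angular lengths: if `‖h'(z)‖ ≤ K ‖g'(z)‖` at the points of the circle
`{|z - p| = |ρ|}` lying in `V ⊆ U'`, then `angLenAt V h p ρ ≤ K · angLenAt U' g p ρ`. [folklore] -/
theorem angLenAt_le_mul {V U' : Set ℂ} (hVU : V ⊆ U') {h g : ℂ → ℂ} {p : ℂ} {ρ K : ℝ}
    (hK : 0 ≤ K) (hder : ∀ z ∈ V ∩ sphere p |ρ|, ‖deriv h z‖ ≤ K * ‖deriv g z‖) :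
    angLenAt V h p ρ ≤ ENNReal.ofReal K * angLenAt U' g p ρ := by
  unfold angLenAt
  rw [← lintegral_const_mul' _ _ ENNReal.ofReal_ne_top]
  refine lintegral_mono fun t ↦ ?_
  by_cases ht : circleMap p ρ t ∈ V
  · have hs : circleMap p ρ t ∈ sphere p |ρ| := circleMap_mem_sphere' p ρ t
    rw [derOn, indicator_of_mem ht, derOn, indicator_of_mem (hVU ht), ← ENNReal.ofReal_mul hK]
    exact ENNReal.ofReal_le_ofReal (hder _ ⟨ht, hs⟩)
  · rw [derOn, indicator_of_notMem ht]
    exact bot_le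

/-! ### The theorem -/

/-- **Far boundary features have small conformal images.** Let `U ⊆ ℂ` be open and `g : U → 𝔻`
a conformal bijection onto the unit disc with holomorphic inverse `f` (`g ∘ f = id` on `𝔻`,
`f ∘ g = id` on `U`). Let `Q ⊆ U ∩ B(p, d)` be preconnected, `0 < d < 1`, let `b ∉ U` with
`‖b - p‖ ≤ 1`, and suppose the base point is far: `‖f 0 - p‖ ≥ 2`. Then for all `z₁, z₂ ∈ Q`,
`‖g z₁ - g z₂‖ ≤ 1400 / √(log (1/d))`. (Length–area about `p`, Pommerenke (1992), Prop. 2.2 /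
Cor. 2.3, with the circle and radial tricks of the module docstring; the function-theoretic
form of "the harmonic measure from the base point of a small set adjacent to the boundary and
far away is small", as used by Lawler–Schramm–Werner (2004), §4.2.)
[cite: PommerenkeBBCM1992, Prop. 2.2] -/
theorem norm_sub_le_of_far {U : Set ℂ} (hU : IsOpen U) {g f : ℂ → ℂ}
    (hg : DifferentiableOn ℂ g U) (hgU : MapsTo g U (ball 0 1))
    (hf : DifferentiableOn ℂ f (ball 0 1)) (hfU : MapsTo f (ball 0 1) U)
    (hgf : ∀ w ∈ ball (0 : ℂ) 1, g (f w) = w) (hfg : ∀ z ∈ U, f (g z) = z)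
    {p b : ℂ} (hb : b ∉ U) (hbp : ‖b - p‖ ≤ 1) (hfar : 2 ≤ ‖f 0 - p‖)
    {d : ℝ} (hd : 0 < d) (hd1 : d < 1) {Q : Set ℂ} (hQ : IsPreconnected Q) (hQU : Q ⊆ U)
    (hQd : Q ⊆ ball p d) {z₁ z₂ : ℂ} (hz₁ : z₁ ∈ Q) (hz₂ : z₂ ∈ Q) :
    ‖g z₁ - g z₂‖ ≤ 1400 / √(Real.log (1 / d)) := by
  have hinj : InjOn g U := fun a ha a' ha' haa ↦ by rw [← hfg a ha, ← hfg a' ha', haa]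
  have hfinj : InjOn f (ball 0 1) := fun a ha a' ha' haa ↦ by rw [← hgf a ha, ← hgf a' ha', haa]
  have hlog : 0 < Real.log (1 / d) := Real.log_pos (by rw [lt_div_iff₀ hd]; linarith)
  /- Step 1: length–area about `p` -/
  set U' : Set ℂ := U ∩ ball p 1 with hU'
  have hU'o : IsOpen U' := hU.inter isOpen_ball
  have hg' : DifferentiableOn ℂ g U' := hg.mono inter_subset_left
  have hinj' : InjOn g U' := hinj.mono inter_subset_left
  have hvol : volume (g '' U') ≤ ENNReal.ofReal (1 ^ 2 * π) := by
    refine (measure_mono (show g '' U' ⊆ ball 0 1 from ?_)).trans (le_of_eq ?_)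
    · rintro _ ⟨z, hz, rfl⟩
      exact hgU hz.1
    · rw [Complex.volume_ball, ENNReal.ofReal_mul (by positivity),
        ← ENNReal.ofReal_pow (by positivity), ← NNReal.coe_real_pi, ENNReal.ofReal_coe_nnreal]
  set K : ℝ≥0∞ := ENNReal.ofReal (2 * π) * ENNReal.ofReal (1 ^ 2 * π) with hKdef
  have hKtop : K ≠ ⊤ := ENNReal.mul_ne_top ENNReal.ofReal_ne_top ENNReal.ofReal_ne_top
  have hKreal : K.toReal = 2 * π * (1 ^ 2 * π) := by
    rw [hKdef, ENNReal.toReal_mul, ENNReal.toReal_ofReal (by positivity),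
      ENNReal.toReal_ofReal (by positivity)]
  have hLA : ∫⁻ r in Ioi (0 : ℝ), ENNReal.ofReal r * angLenAt U' g p r ^ 2 ≤ K :=
    (lintegral_angLenAt_sq_le hU'o hg' hinj' p).trans (by rw [hKdef]; gcongr)
  set c₀ : ℝ := √(4 * (K.toReal + 1) / Real.log (1 / d)) with hc₀def
  have hc₀ : 0 ≤ c₀ := Real.sqrt_nonneg _
  obtain ⟨ρ, ⟨hdρ, hρd⟩, hρ⟩ := exists_mem_Ioo_mul_le hLA hKtop hd hd1
  have hρ0 : 0 < ρ := hd.trans hdρ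
  have hρ1 : ρ < 1 := hρd.trans ((Real.sqrt_lt' one_pos).2 (by simpa using hd1))
  have hfar1 : ρ < ‖f 0 - p‖ := by linarith
  have hmemU' : ∀ z ∈ U ∩ sphere p ρ, z ∈ U' := fun z hz ↦
    ⟨hz.1, by rw [mem_ball]; exact (mem_sphere.1 hz.2).trans_lt hρ1⟩
  /- Step 2: `|g| ≥ 1/48` on the circle piece -/
  have hlow : ∀ z ∈ U ∩ sphere p ρ, (1 / 48 : ℝ) ≤ ‖g z‖ := fun z hz ↦ by
    have hw : ‖g z‖ < 1 := mem_ball_zero_iff.1 (hgU hz.1)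
    refine one_div_le_norm_of_far hf hfinj hfU hb hbp hfar hw ?_
    rw [hfg z hz.1, ← dist_eq_norm, mem_sphere.1 hz.2]
    exact hρ1.le
  have hne0 : ∀ z ∈ U ∩ sphere p ρ, g z ≠ 0 := fun z hz h0 ↦ by
    have := hlow z hz
    rw [h0, norm_zero] at this
    linarith
  /- Step 5: the measure bounds, via `log ∘ g` and `log ∘ (-g)` -/
  set U₁ : Set ℂ := U' ∩ g ⁻¹' slitPlane with hU₁
  set U₂ : Set ℂ := U' ∩ (fun z ↦ -g z) ⁻¹' slitPlane with hU₂
  have hU₁o : IsOpen U₁ := hg'.continuousOn.isOpen_inter_preimage hU'o isOpen_slitPlane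
  have hU₂o : IsOpen U₂ := hg'.continuousOn.neg.isOpen_inter_preimage hU'o isOpen_slitPlane
  set h₁ : ℂ → ℂ := fun z ↦ Complex.log (g z) with hh₁def
  set h₂ : ℂ → ℂ := fun z ↦ Complex.log (-g z) with hh₂def
  have hh₁ : DifferentiableOn ℂ h₁ U₁ := fun z hz ↦
    ((hg' z hz.1).mono inter_subset_left).clog hz.2
  have hh₂ : DifferentiableOn ℂ h₂ U₂ := fun z hz ↦
    ((hg' z hz.1).mono inter_subset_left).neg.clog hz.2
  have hgz : ∀ z ∈ U', HasDerivAt g (deriv g z) z := fun z hz ↦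
    (hg'.differentiableAt (hU'o.mem_nhds hz)).hasDerivAt
  have hder₁ : ∀ z ∈ U₁ ∩ sphere p |ρ|, ‖deriv h₁ z‖ ≤ 48 * ‖deriv g z‖ := by
    rintro z ⟨hzU₁, hzs⟩
    rw [abs_of_pos hρ0] at hzs
    have hl := hlow z ⟨hzU₁.1.1, hzs⟩
    rw [((hgz z hzU₁.1).clog hzU₁.2).deriv, norm_div, div_le_iff₀ (by linarith)]
    nlinarith [norm_nonneg (deriv g z)]
  have hder₂ : ∀ z ∈ U₂ ∩ sphere p |ρ|, ‖deriv h₂ z‖ ≤ 48 * ‖deriv g z‖ := by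
    rintro z ⟨hzU₂, hzs⟩
    rw [abs_of_pos hρ0] at hzs
    have hl := hlow z ⟨hzU₂.1.1, hzs⟩
    have hh : HasDerivAt h₂ (-deriv g z / -g z) z := (hgz z hzU₂.1).neg.clog hzU₂.2
    rw [hh.deriv, norm_div, norm_neg, norm_neg, div_le_iff₀ (by linarith)]
    nlinarith [norm_nonneg (deriv g z)]
  have hcomp₁ : angLenAt U₁ h₁ p ρ ≤ ENNReal.ofReal 48 * angLenAt U' g p ρ :=
    angLenAt_le_mul inter_subset_left (by norm_num) hder₁
  have hcomp₂ : angLenAt U₂ h₂ p ρ ≤ ENNReal.ofReal 48 * angLenAt U' g p ρ :=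
    angLenAt_le_mul inter_subset_left (by norm_num) hder₂
  have hbound : ∀ {V : Set ℂ} {h : ℂ → ℂ} (L : ℂ →L[ℝ] ℝ), IsOpen V → DifferentiableOn ℂ h V →
      angLenAt V h p ρ ≤ ENNReal.ofReal 48 * angLenAt U' g p ρ → (∀ z, |L z| ≤ ‖z‖) →
      volume (L '' (h '' (V ∩ sphere p ρ))) ≤ ENNReal.ofReal (48 * c₀) := by
    intro V h L hVo hhV hcomp hL
    calc volume (L '' (h '' (V ∩ sphere p ρ))) ≤ ENNReal.ofReal ρ * angLenAt V h p ρ :=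
          volume_image_image_le hVo hhV hρ0 L hL
      _ ≤ ENNReal.ofReal ρ * (ENNReal.ofReal 48 * angLenAt U' g p ρ) := by gcongr
      _ = ENNReal.ofReal 48 * (ENNReal.ofReal ρ * angLenAt U' g p ρ) := by ring
      _ ≤ ENNReal.ofReal 48 * ENNReal.ofReal c₀ := by gcongr
      _ = ENNReal.ofReal (48 * c₀) := (ENNReal.ofReal_mul (by norm_num)).symm
  have hre : ∀ z : ℂ, |reCLM z| ≤ ‖z‖ := fun z ↦ by simpa using abs_re_le_norm z
  have him : ∀ z : ℂ, |imCLM z| ≤ ‖z‖ := fun z ↦ by simpa using abs_im_le_norm z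
  have hv₁re := hbound reCLM hU₁o hh₁ hcomp₁ hre
  have hv₂re := hbound reCLM hU₂o hh₂ hcomp₂ hre
  have hv₁im := hbound imCLM hU₁o hh₁ hcomp₁ him
  have hv₂im := hbound imCLM hU₂o hh₂ hcomp₂ him
  -- the three sets over `Γ_ρ = g(U ∩ {|z - p| = ρ})`
  set Γ : Set ℂ := g '' (U ∩ sphere p ρ) with hΓ
  set Mset : Set ℝ := (fun w ↦ Real.log ‖w‖) '' Γ with hMset
  set A₁ : Set ℝ := arg '' Γ with hA₁
  set A₂ : Set ℝ := (fun w ↦ arg (-w)) '' Γ with hA₂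
  have hMsub : Mset ⊆ reCLM '' (h₁ '' (U₁ ∩ sphere p ρ)) ∪ reCLM '' (h₂ '' (U₂ ∩ sphere p ρ)) := by
    rintro _ ⟨_, ⟨z, hz, rfl⟩, rfl⟩
    rcases mem_slitPlane_or_neg_mem_slitPlane (hne0 z hz) with h | h
    · exact Or.inl ⟨h₁ z, ⟨z, ⟨⟨hmemU' z hz, h⟩, hz.2⟩, rfl⟩, by simp [hh₁def, Complex.log_re]⟩
    · exact Or.inr ⟨h₂ z, ⟨z, ⟨⟨hmemU' z hz, h⟩, hz.2⟩, rfl⟩,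
        by simp [hh₂def, Complex.log_re, norm_neg]⟩
  have hA₁sub : A₁ ⊆ imCLM '' (h₁ '' (U₁ ∩ sphere p ρ)) ∪ {π} := by
    rintro _ ⟨_, ⟨z, hz, rfl⟩, rfl⟩
    by_cases h : g z ∈ slitPlane
    · exact Or.inl ⟨h₁ z, ⟨z, ⟨⟨hmemU' z hz, h⟩, hz.2⟩, rfl⟩, by simp [hh₁def, Complex.log_im]⟩
    · exact Or.inr (arg_eq_pi_of_not_mem_slitPlane h (hne0 z hz))
  have hA₂sub : A₂ ⊆ imCLM '' (h₂ '' (U₂ ∩ sphere p ρ)) ∪ {π} := by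
    rintro _ ⟨_, ⟨z, hz, rfl⟩, rfl⟩
    by_cases h : -g z ∈ slitPlane
    · exact Or.inl ⟨h₂ z, ⟨z, ⟨⟨hmemU' z hz, h⟩, hz.2⟩, rfl⟩, by simp [hh₂def, Complex.log_im]⟩
    · exact Or.inr (arg_eq_pi_of_not_mem_slitPlane h (neg_ne_zero.2 (hne0 z hz)))
  have hvM : volume Mset ≤ ENNReal.ofReal (96 * c₀) := by
    calc volume Mset ≤ volume (reCLM '' (h₁ '' (U₁ ∩ sphere p ρ))) +
          volume (reCLM '' (h₂ '' (U₂ ∩ sphere p ρ))) :=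
          (measure_mono hMsub).trans (measure_union_le _ _)
      _ ≤ ENNReal.ofReal (48 * c₀) + ENNReal.ofReal (48 * c₀) := add_le_add hv₁re hv₂re
      _ = ENNReal.ofReal (96 * c₀) := by
          rw [← ENNReal.ofReal_add (by positivity) (by positivity)]; ring_nf
  have hvA₁ : volume A₁ ≤ ENNReal.ofReal (48 * c₀) := by
    calc volume A₁ ≤ volume (imCLM '' (h₁ '' (U₁ ∩ sphere p ρ))) + volume ({π} : Set ℝ) :=
          (measure_mono hA₁sub).trans (measure_union_le _ _)
      _ ≤ ENNReal.ofReal (48 * c₀) + 0 := add_le_add hv₁im (by rw [measure_singleton])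
      _ = ENNReal.ofReal (48 * c₀) := add_zero _
  have hvA₂ : volume A₂ ≤ ENNReal.ofReal (48 * c₀) := by
    calc volume A₂ ≤ volume (imCLM '' (h₂ '' (U₂ ∩ sphere p ρ))) + volume ({π} : Set ℝ) :=
          (measure_mono hA₂sub).trans (measure_union_le _ _)
      _ ≤ ENNReal.ofReal (48 * c₀) + 0 := add_le_add hv₂im (by rw [measure_singleton])
      _ = ENNReal.ofReal (48 * c₀) := add_zero _
  /- Steps 3–4: the values over `Q` lie in these sets -/
  have hQρ : ∀ q ∈ Q, ‖q - p‖ < ρ := fun q hq ↦ by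
    have := hQd hq
    rw [mem_ball, dist_eq_norm] at this
    exact this.trans hdρ
  have hgq0 : ∀ q ∈ Q, g q ≠ 0 := fun q hq h0 ↦ by
    have : q = f 0 := by rw [← hfg q (hQU hq), h0]
    have h2 := hQρ q hq
    rw [this] at h2
    linarith
  have hgq1 : ∀ q ∈ Q, ‖g q‖ ≤ 1 := fun q hq ↦ (mem_ball_zero_iff.1 (hgU (hQU hq))).le
  have hM : ∀ q ∈ Q, Real.log ‖g q‖ ∈ Mset := fun q hq ↦ by
    obtain ⟨z, hz, hzq⟩ := exists_mem_sphere_norm_eq hf hfU hgU hfg hgf hfar1 (hQU hq) (hQρ q hq)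
    exact ⟨g z, ⟨z, hz, rfl⟩, by simp [hzq]⟩
  have hA₁Q : ∀ q ∈ Q, arg (g q) ∈ A₁ := fun q hq ↦ by
    obtain ⟨z, hz, t, ht, hzt⟩ :=
      exists_mem_sphere_eq_mul hf hfU hgU hfg hgf hfar1 (hQU hq) (hQρ q hq)
    exact ⟨g z, ⟨z, hz, rfl⟩, by rw [hzt, arg_real_mul _ ht]⟩
  have hA₂Q : ∀ q ∈ Q, arg (-g q) ∈ A₂ := fun q hq ↦ by
    obtain ⟨z, hz, t, ht, hzt⟩ :=
      exists_mem_sphere_eq_mul hf hfU hgU hfg hgf hfar1 (hQU hq) (hQρ q hq)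
    refine ⟨g z, ⟨z, hz, rfl⟩, ?_⟩
    show arg (-g z) = arg (-g q)
    rw [hzt, show -((t : ℂ) * g q) = t * -g q by ring, arg_real_mul _ ht]
  /- Step 6: the moduli -/
  have hgc : ContinuousOn g Q := hg.continuousOn.mono hQU
  have hmod : |‖g z₁‖ - ‖g z₂‖| ≤ 96 * c₀ := by
    have hcont : ContinuousOn (fun q ↦ Real.log ‖g q‖) Q :=
      hgc.norm.log fun q hq ↦ (norm_pos_iff.2 (hgq0 q hq)).ne'
    have hS : ((fun q ↦ Real.log ‖g q‖) '' Q).OrdConnected := (hQ.image _ hcont).ordConnected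
    have hST : (fun q ↦ Real.log ‖g q‖) '' Q ⊆ Mset := by
      rintro _ ⟨q, hq, rfl⟩; exact hM q hq
    have h := abs_sub_le_of_ordConnected hS hST (by positivity) hvM ⟨z₁, hz₁, rfl⟩ ⟨z₂, hz₂, rfl⟩
    exact (abs_sub_le_abs_log_sub_log (norm_pos_iff.2 (hgq0 z₁ hz₁)) (hgq1 z₁ hz₁)
      (norm_pos_iff.2 (hgq0 z₂ hz₂)) (hgq1 z₂ hz₂)).trans h
  /- Step 6: the arguments, three cases; the bound `144 c₀` -/
  have hmain : ‖g z₁ - g z₂‖ ≤ 144 * c₀ := by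
    by_cases hc1 : ∀ q ∈ Q, g q ∈ slitPlane
    · -- `g(Q)` misses the negative axis: `arg ∘ g` is continuous on `Q`
      have hcont : ContinuousOn (fun q ↦ arg (g q)) Q := continuousOn_arg.comp hgc hc1
      have hS : ((fun q ↦ arg (g q)) '' Q).OrdConnected := (hQ.image _ hcont).ordConnected
      have hST : (fun q ↦ arg (g q)) '' Q ⊆ A₁ := by
        rintro _ ⟨q, hq, rfl⟩; exact hA₁Q q hq
      have h := abs_sub_le_of_ordConnected hS hST (by positivity) hvA₁ ⟨z₁, hz₁, rfl⟩
        ⟨z₂, hz₂, rfl⟩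
      calc ‖g z₁ - g z₂‖ ≤ |‖g z₁‖ - ‖g z₂‖| + |arg (g z₁) - arg (g z₂)| :=
            norm_sub_le_abs_norm_sub_add_abs_arg_sub _ (hgq1 z₂ hz₂)
        _ ≤ 96 * c₀ + 48 * c₀ := add_le_add hmod h
        _ = 144 * c₀ := by ring
    by_cases hc2 : ∀ q ∈ Q, -g q ∈ slitPlane
    · -- `g(Q)` misses the positive axis: `arg ∘ (-g)` is continuous on `Q`
      have hcont : ContinuousOn (fun q ↦ arg (-g q)) Q := continuousOn_arg.comp hgc.neg hc2
      have hS : ((fun q ↦ arg (-g q)) '' Q).OrdConnected := (hQ.image _ hcont).ordConnected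
      have hST : (fun q ↦ arg (-g q)) '' Q ⊆ A₂ := by
        rintro _ ⟨q, hq, rfl⟩; exact hA₂Q q hq
      have h := abs_sub_le_of_ordConnected hS hST (by positivity) hvA₂ ⟨z₁, hz₁, rfl⟩
        ⟨z₂, hz₂, rfl⟩
      calc ‖g z₁ - g z₂‖ = ‖(-g z₁) - (-g z₂)‖ := by rw [neg_sub_neg, norm_sub_rev]
        _ ≤ |‖-g z₁‖ - ‖-g z₂‖| + |arg (-g z₁) - arg (-g z₂)| :=
            norm_sub_le_abs_norm_sub_add_abs_arg_sub _ (by rw [norm_neg]; exact hgq1 z₂ hz₂)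
        _ ≤ 96 * c₀ + 48 * c₀ := by rw [norm_neg, norm_neg]; exact add_le_add hmod h
        _ = 144 * c₀ := by ring
    · -- `g(Q)` meets both half-axes: `|arg ∘ g|` covers `[0, π]`, so `π ≤ 96 c₀`
      push Not at hc1 hc2
      obtain ⟨qm, hqm, hqm'⟩ := hc1
      obtain ⟨qp, hqp, hqp'⟩ := hc2
      have hπm : arg (g qm) = π := arg_eq_pi_of_not_mem_slitPlane hqm' (hgq0 qm hqm)
      have h0p : arg (g qp) = 0 := by
        have h := arg_eq_pi_iff.1
          (arg_eq_pi_of_not_mem_slitPlane hqp' (neg_ne_zero.2 (hgq0 qp hqp)))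
        rw [neg_re, neg_im, neg_lt_zero, neg_eq_zero] at h
        exact arg_eq_zero_iff.2 ⟨h.1.le, h.2⟩
      set Φ : ℂ → ℝ := fun q ↦ Real.arccos ((g q).re / ‖g q‖) with hΦ
      have hΦeq : ∀ q ∈ Q, Φ q = |arg (g q)| := fun q hq ↦ (abs_arg_eq_arccos (hgq0 q hq)).symm
      have hΦc : ContinuousOn Φ Q := by
        refine Real.continuous_arccos.comp_continuousOn ?_
        exact (Complex.continuous_re.comp_continuousOn hgc).div hgc.norm
          fun q hq ↦ (norm_pos_iff.2 (hgq0 q hq)).ne'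
      have hIcc : Icc 0 π ⊆ Φ '' Q := by
        refine (hQ.image Φ hΦc).Icc_subset ⟨qp, hqp, ?_⟩ ⟨qm, hqm, ?_⟩
        · rw [hΦeq qp hqp, h0p, abs_zero]
        · rw [hΦeq qm hqm, hπm, abs_of_pos Real.pi_pos]
      have hsub : Icc 0 π ⊆ A₁ ∪ -A₁ := by
        intro y hy
        obtain ⟨q, hq, hqy⟩ := hIcc hy
        rw [hΦeq q hq] at hqy
        rcases (abs_eq hy.1).1 hqy with h | h
        · exact Or.inl (h ▸ hA₁Q q hq)
        · refine Or.inr ?_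
          rw [Set.mem_neg, ← h]
          exact hA₁Q q hq
      have hπle : π ≤ 96 * c₀ := by
        have h1 : volume (Icc (0 : ℝ) π) ≤ ENNReal.ofReal (96 * c₀) := by
          calc volume (Icc (0 : ℝ) π) ≤ volume A₁ + volume (-A₁) :=
                (measure_mono hsub).trans (measure_union_le _ _)
            _ = volume A₁ + volume A₁ := by rw [Measure.measure_neg]
            _ ≤ ENNReal.ofReal (48 * c₀) + ENNReal.ofReal (48 * c₀) := add_le_add hvA₁ hvA₁
            _ = ENNReal.ofReal (96 * c₀) := by
                rw [← ENNReal.ofReal_add (by positivity) (by positivity)]; ring_nf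
        rw [Real.volume_Icc, sub_zero, ENNReal.ofReal_le_ofReal_iff (by positivity)] at h1
        exact h1
      calc ‖g z₁ - g z₂‖ ≤ ‖g z₁‖ + ‖g z₂‖ := norm_sub_le _ _
        _ ≤ 1 + 1 := add_le_add (hgq1 z₁ hz₁) (hgq1 z₂ hz₂)
        _ ≤ π := by linarith [Real.two_le_pi]
        _ ≤ 144 * c₀ := by linarith
  /- the constant -/
  have hc_le : 144 * c₀ ≤ 1400 / √(Real.log (1 / d)) := by
    rw [hc₀def, hKreal, Real.sqrt_div' _ hlog.le, ← mul_div_assoc,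
      div_le_div_iff_of_pos_right (Real.sqrt_pos.2 hlog)]
    have hπ : π < 3.15 := Real.pi_lt_d2
    have hπ0 : 0 < π := Real.pi_pos
    have hkey : 4 * (2 * π * (1 ^ 2 * π) + 1) ≤ (1400 / 144) ^ 2 := by nlinarith
    calc 144 * √(4 * (2 * π * (1 ^ 2 * π) + 1)) ≤ 144 * √((1400 / 144) ^ 2) := by
          gcongr
      _ = 1400 := by rw [Real.sqrt_sq (by norm_num)]; norm_num
  exact hmain.trans hc_le

/-- **Far boundary features have small conformal images, at an arbitrary scale.** As
`norm_sub_le_of_far`, for a preconnected `Q ⊆ U ∩ B(p, r)`, a point `b ∉ U` with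
`‖b - p‖ ≤ R/2`, and the base point at distance `‖f 0 - p‖ ≥ R`, `0 < r < R/2`: for all
`z₁, z₂ ∈ Q`, `‖g z₁ - g z₂‖ ≤ 1400 / √(log (R / (2r)))` (apply the normalised statement to
`z ↦ g (p + (R/2) z)`). In particular the image of a boundary feature of size `r = 1` at distance
`R` from the base point has diameter `O(1/√(log R))`. [cite: PommerenkeBBCM1992, Prop. 2.2] -/
theorem norm_sub_le_of_far_scaled {U : Set ℂ} (hU : IsOpen U) {g f : ℂ → ℂ}
    (hg : DifferentiableOn ℂ g U) (hgU : MapsTo g U (ball 0 1))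
    (hf : DifferentiableOn ℂ f (ball 0 1)) (hfU : MapsTo f (ball 0 1) U)
    (hgf : ∀ w ∈ ball (0 : ℂ) 1, g (f w) = w) (hfg : ∀ z ∈ U, f (g z) = z)
    {p b : ℂ} (hb : b ∉ U) {r R : ℝ} (hr : 0 < r) (hrR : r < R / 2) (hbp : ‖b - p‖ ≤ R / 2)
    (hfar : R ≤ ‖f 0 - p‖) {Q : Set ℂ} (hQ : IsPreconnected Q) (hQU : Q ⊆ U)
    (hQr : Q ⊆ ball p r) {z₁ z₂ : ℂ} (hz₁ : z₁ ∈ Q) (hz₂ : z₂ ∈ Q) :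
    ‖g z₁ - g z₂‖ ≤ 1400 / √(Real.log (R / (2 * r))) := by
  set l : ℝ := R / 2 with hl
  have hl0 : 0 < l := hr.trans hrR
  have hlc : (l : ℂ) ≠ 0 := by exact_mod_cast hl0.ne'
  -- the affine change of variables `σ z = p + l z`, `τ z = (z - p)/l`
  set σ : ℂ → ℂ := fun z ↦ p + l * z with hσ
  set τ : ℂ → ℂ := fun z ↦ (z - p) / l with hτ
  have hστ : ∀ z, σ (τ z) = z := fun z ↦ by simp only [hσ, hτ]; field_simp; ring
  have hτσ : ∀ z, τ (σ z) = z := fun z ↦ by simp only [hσ, hτ]; field_simp; ring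
  have hσd : Differentiable ℂ σ := by simp only [hσ]; fun_prop
  have hτd : Differentiable ℂ τ := by simp only [hτ]; fun_prop
  have hnormτ : ∀ z, ‖τ z‖ = ‖z - p‖ / l := fun z ↦ by
    simp only [hτ, norm_div, Complex.norm_real, Real.norm_eq_abs, abs_of_pos hl0]
  set V : Set ℂ := σ ⁻¹' U with hV
  have hVo : IsOpen V := hU.preimage hσd.continuous
  have hg' : DifferentiableOn ℂ (g ∘ σ) V := hg.comp hσd.differentiableOn fun z hz ↦ hz
  have hgV : MapsTo (g ∘ σ) V (ball 0 1) := fun z hz ↦ hgU hz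
  have hf' : DifferentiableOn ℂ (τ ∘ f) (ball 0 1) := hτd.comp_differentiableOn hf
  have hfV : MapsTo (τ ∘ f) (ball 0 1) V := fun w hw ↦ by
    show σ (τ (f w)) ∈ U
    rw [hστ]; exact hfU hw
  have hgf' : ∀ w ∈ ball (0 : ℂ) 1, (g ∘ σ) ((τ ∘ f) w) = w := fun w hw ↦ by
    simp only [Function.comp_apply, hστ]; exact hgf w hw
  have hfg' : ∀ z ∈ V, (τ ∘ f) ((g ∘ σ) z) = z := fun z hz ↦ by
    simp only [Function.comp_apply]
    rw [hfg _ hz, hτσ]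
  have hb' : τ b ∉ V := by
    show σ (τ b) ∉ U
    rwa [hστ]
  have hbp' : ‖τ b - 0‖ ≤ 1 := by
    rw [sub_zero, hnormτ, div_le_one hl0]; exact hbp
  have hfar' : 2 ≤ ‖(τ ∘ f) 0 - 0‖ := by
    rw [sub_zero, Function.comp_apply, hnormτ, le_div_iff₀ hl0]
    linarith
  set d : ℝ := r / l with hd
  have hd0 : 0 < d := div_pos hr hl0
  have hd1 : d < 1 := (div_lt_one hl0).2 hrR
  have hQ' : IsPreconnected (τ '' Q) := hQ.image τ hτd.continuous.continuousOn
  have hQV : τ '' Q ⊆ V := by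
    rintro _ ⟨q, hq, rfl⟩
    show σ (τ q) ∈ U
    rw [hστ]; exact hQU hq
  have hQd : τ '' Q ⊆ ball 0 d := by
    rintro _ ⟨q, hq, rfl⟩
    rw [mem_ball_zero_iff, hnormτ, hd, div_lt_div_iff_of_pos_right hl0, ← dist_eq_norm]
    exact hQr hq
  have h := norm_sub_le_of_far hVo hg' hgV hf' hfV hgf' hfg' hb' hbp' hfar' hd0 hd1 hQ' hQV hQd
    ⟨z₁, hz₁, rfl⟩ ⟨z₂, hz₂, rfl⟩
  simp only [Function.comp_apply, hστ] at h
  have h1d : 1 / d = R / (2 * r) := by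
    rw [hd, hl]; field_simp
  rwa [h1d] at h

/-! ### Uniform smallness when the inner radius at the base point is large -/

/-- **Schwarz–Pick bound for maps into the disc**: if `g` maps the disc `B(x, d) ⊆ U` into `𝔻`
then `‖g'(x)‖ ≤ 2/d`. [folklore] -/
theorem norm_deriv_le_of_ball_subset {U : Set ℂ} {g : ℂ → ℂ} (hg : DifferentiableOn ℂ g U)
    (hgU : MapsTo g U (ball 0 1)) {x : ℂ} {d : ℝ} (hd : 0 < d) (hsub : ball x d ⊆ U) :
    ‖deriv g x‖ ≤ 2 / d := by
  refine Complex.norm_deriv_le_div_of_mapsTo_ball (hg.mono hsub) (fun z hz ↦ ?_) hd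
  have h1 : ‖g z‖ < 1 := mem_ball_zero_iff.1 (hgU (hsub hz))
  have h2 : ‖g x‖ < 1 := mem_ball_zero_iff.1 (hgU (hsub (mem_ball_self hd)))
  rw [mem_closedBall, dist_eq_norm]
  calc ‖g z - g x‖ ≤ ‖g z‖ + ‖g x‖ := norm_sub_le _ _
    _ ≤ 2 := by linarith

/-- **Deep sets have small conformal images**: if `B(p, d + 1) ⊆ U` (`d > 0`) then for
`z₁, z₂ ∈ B(p, 1)`, `‖g z₁ - g z₂‖ ≤ 4/d` (Schwarz–Pick on the discs `B(x, d)`, `x ∈ B(p, 1)`, and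
the mean value inequality on the convex disc `B(p, 1)`). [folklore] -/
theorem norm_sub_le_of_deep {U : Set ℂ} {g : ℂ → ℂ} (hg : DifferentiableOn ℂ g U)
    (hgU : MapsTo g U (ball 0 1)) {p : ℂ} {d : ℝ} (hd : 0 < d) (hsub : ball p (d + 1) ⊆ U)
    {z₁ z₂ : ℂ} (hz₁ : z₁ ∈ ball p 1) (hz₂ : z₂ ∈ ball p 1) : ‖g z₁ - g z₂‖ ≤ 4 / d := by
  have hballU : ball p 1 ⊆ U := (ball_subset_ball (by linarith)).trans hsub
  have hxd : ∀ x ∈ ball p 1, ball x d ⊆ U := fun x hx ↦ by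
    refine Subset.trans ?_ hsub
    intro z hz
    rw [mem_ball] at hx hz ⊢
    calc dist z p ≤ dist z x + dist x p := dist_triangle _ _ _
      _ < d + 1 := add_lt_add hz hx
  have hbound : ∀ x ∈ ball p 1, ‖deriv g x‖ ≤ 2 / d := fun x hx ↦
    norm_deriv_le_of_ball_subset hg hgU hd (hxd x hx)
  have hdiff : ∀ x ∈ ball p 1, DifferentiableAt ℂ g x := fun x hx ↦
    hg.differentiableAt ((isOpen_ball.mem_nhds (mem_ball_self hd)) |> fun h ↦
      Filter.mem_of_superset h (hxd x hx))
  have h := (convex_ball p 1).norm_image_sub_le_of_norm_deriv_le hdiff hbound hz₂ hz₁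
  have h12 : ‖z₁ - z₂‖ ≤ 2 := by
    rw [mem_ball, dist_eq_norm] at hz₁ hz₂
    calc ‖z₁ - z₂‖ = ‖(z₁ - p) - (z₂ - p)‖ := by ring_nf
      _ ≤ ‖z₁ - p‖ + ‖z₂ - p‖ := norm_sub_le _ _
      _ ≤ 2 := by linarith
  calc ‖g z₁ - g z₂‖ ≤ 2 / d * ‖z₁ - z₂‖ := h
    _ ≤ 2 / d * 2 := by gcongr
    _ = 4 / d := by ring

/-- **Unit-size connected sets have uniformly small conformal images when the inner radius at the
base point is large** (the form in which Lawler–Schramm–Werner (2004) use the smallness of lattice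
steps in conformal coordinates throughout §3–§5, e.g. "if `v_j` is the vertex in `D` closest to
`w_j`, then, provided that `δ` is sufficiently small, …", and §4.2, the existence of `Q₀`): let
`g : U → 𝔻` be conformal with holomorphic inverse `f`, `B(f 0, ρ) ⊆ U` with `ρ ≥ 8`, and
`Q ⊆ U ∩ B(p, 1)` preconnected. Then for `z₁, z₂ ∈ Q`, `‖g z₁ - g z₂‖ ≤ 1500 / √(log (ρ/3))`.
Proof: with `R = ‖f 0 - p‖`, either some `b ∉ U` has `‖b - p‖ ≤ R/2` — then `R ≥ 2ρ/3` and
`norm_sub_le_of_far_scaled` gives `1400/√(log(R/2))` — or `B(p, R/2) ⊆ U`, and then `Q` is deep: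
`B(p, ρ/4) ⊆ U` (as `R ≥ ρ/2`, or `B(p, ρ/2) ⊆ B(f 0, ρ)`), so `norm_sub_le_of_deep` gives
`4/(ρ/4 - 1) ≤ 100/√(log(ρ/3))`. [cite: LawlerSchrammWerner2004, §5.1 (proof of Lemma 5.2)] -/
theorem norm_sub_le_of_inradius {U : Set ℂ} (hU : IsOpen U) {g f : ℂ → ℂ}
    (hg : DifferentiableOn ℂ g U) (hgU : MapsTo g U (ball 0 1))
    (hf : DifferentiableOn ℂ f (ball 0 1)) (hfU : MapsTo f (ball 0 1) U)
    (hgf : ∀ w ∈ ball (0 : ℂ) 1, g (f w) = w) (hfg : ∀ z ∈ U, f (g z) = z)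
    {ρ : ℝ} (hρ : 8 ≤ ρ) (hball : ball (f 0) ρ ⊆ U) {Q : Set ℂ} (hQ : IsPreconnected Q)
    (hQU : Q ⊆ U) {p : ℂ} (hQp : Q ⊆ ball p 1) {z₁ z₂ : ℂ} (hz₁ : z₁ ∈ Q) (hz₂ : z₂ ∈ Q) :
    ‖g z₁ - g z₂‖ ≤ 1500 / √(Real.log (ρ / 3)) := by
  have hlog : 0 < Real.log (ρ / 3) := Real.log_pos (by linarith)
  have hsq : 0 < √(Real.log (ρ / 3)) := Real.sqrt_pos.2 hlog
  -- `√(log(ρ/3)) ≤ √ρ ≤ ρ/... `: the deep bound `16/(ρ-4)` is below `100/√(log(ρ/3))`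
  have hdeep_le : 16 / (ρ - 4) ≤ 100 / √(Real.log (ρ / 3)) := by
    have h1 : Real.log (ρ / 3) ≤ ρ / 3 := (Real.log_le_sub_one_of_pos (by linarith)).trans (by linarith)
    have h2 : √(Real.log (ρ / 3)) ≤ √(ρ / 3) := Real.sqrt_le_sqrt h1
    have h3 : √(ρ / 3) ≤ ρ / 3 + 1 := by
      rw [Real.sqrt_le_left (by linarith)]
      nlinarith
    rw [div_le_div_iff₀ (by linarith) hsq]
    nlinarith [h2.trans h3]
  set R : ℝ := ‖f 0 - p‖ with hR
  by_cases hA : ∃ b ∉ U, ‖b - p‖ ≤ R / 2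
  · -- boundary within `R/2` of `p`: the far-set bound
    obtain ⟨b, hb, hbp⟩ := hA
    have hbρ : ρ ≤ ‖b - f 0‖ := by
      by_contra hlt
      push Not at hlt
      exact hb (hball (mem_ball_iff_norm.2 hlt))
    have hR23 : 2 * ρ / 3 ≤ R := by
      have : ‖b - f 0‖ ≤ ‖b - p‖ + ‖f 0 - p‖ := by
        calc ‖b - f 0‖ = ‖(b - p) - (f 0 - p)‖ := by ring_nf
          _ ≤ ‖b - p‖ + ‖f 0 - p‖ := norm_sub_le _ _
      linarith
    have h := norm_sub_le_of_far_scaled hU hg hgU hf hfU hgf hfg hb one_pos (by linarith) hbp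
      le_rfl hQ hQU hQp hz₁ hz₂
    have hlog2 : Real.log (ρ / 3) ≤ Real.log (R / (2 * 1)) :=
      Real.log_le_log (by linarith) (by linarith)
    calc ‖g z₁ - g z₂‖ ≤ 1400 / √(Real.log (R / (2 * 1))) := h
      _ ≤ 1400 / √(Real.log (ρ / 3)) := by
          gcongr
      _ ≤ 1500 / √(Real.log (ρ / 3)) := by gcongr; norm_num
  · -- `B(p, R/2) ⊆ U`: the set is deep
    push Not at hA
    have hsubR : ball p (R / 2) ⊆ U := fun z hz ↦ by
      by_contra hzU
      have := hA z hzU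
      rw [mem_ball, dist_eq_norm] at hz
      linarith
    have hsub4 : ball p (ρ / 4) ⊆ U := by
      rcases le_or_gt (ρ / 2) R with hRρ | hRρ
      · exact (ball_subset_ball (by linarith)).trans hsubR
      · refine Subset.trans ?_ hball
        intro z hz
        rw [mem_ball, dist_eq_norm] at hz ⊢
        calc ‖z - f 0‖ = ‖(z - p) - (f 0 - p)‖ := by ring_nf
          _ ≤ ‖z - p‖ + ‖f 0 - p‖ := norm_sub_le _ _
          _ < ρ / 4 + ρ / 2 := add_lt_add hz (by rw [← hR]; exact hRρ)
          _ ≤ ρ := by linarith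
    have hd : 0 < ρ / 4 - 1 := by linarith
    have h := norm_sub_le_of_deep hg hgU hd (by rw [sub_add_cancel]; exact hsub4)
      (hQp hz₁) (hQp hz₂)
    calc ‖g z₁ - g z₂‖ ≤ 4 / (ρ / 4 - 1) := h
      _ = 16 / (ρ - 4) := by
          field_simp
          ring
      _ ≤ 100 / √(Real.log (ρ / 3)) := hdeep_le
      _ ≤ 1500 / √(Real.log (ρ / 3)) := by gcongr; norm_num

end FarSet

end Literature.Analysis.Complex
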